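import Mathlib
import Summits.Ventures.HodgeRepro.Tier4.Common.FundamentalDomainExists

/-!
# Tier4/Common/FundamentalDomainSaturation — a fundamental domain of a discrete subgroup that contains a
neighbourhood of `1` and is RELATIVELY COMPACT ON `Γ`-SATURATIONS OF COMPACTS; discreteness of a subgroup meeting a
neighbourhood of `1` in a finite set

Blind re-derivation cell `pub-hodge-repro`, Tier 4 (README §9–§10), seat t4-typer-2 (gen 4).  Target tree path
`lean/Summits/Ventures/HodgeRepro/Tier4/Common/FundamentalDomainSaturation.lean`.  Imports: Mathlib and
`Common.FundamentalDomainExists` (the cover construction `domainOfCover`, typer-2 g0, p665991).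

WHY (plan-4 g3, bus S14455, Part 6 of the factorisation chain = C-L4-ZDOMAIN-EX): the `Z(k)`-fundamental domain
`DZ_f ⊆ T_f` that FINSUM's `hpos` needs must (a) contain a neighbourhood of `1` and (b) have `DZ_f ∩ C·Z_f`
relatively compact for every compact `C` — `DZ_f` itself is NOT relatively compact (`T_f/Z_f` is not compact).  S14455
priced (b) as «`Z(k)\Z_f` compact + a Borel section of `T_f → T_f/Z_f` relatively compact on compacts (Mackey 1952
Lemma 1.1 / Feldman–Greenleaf 1968) — a Literature fact unless Mathlib has the transversal».  NO SECTION IS NEEDED: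
the cover construction of `FundamentalDomainExists` already produces such a domain for ANY discrete subgroup `Γ` of a
locally compact second-countable group, with no cocompactness and no quotient:
  `D := ⋃ n, (V n ∖ ⋃ m < n, Γ • V m)` for a countable cover by small relatively compact open sets `V n`.
* `V 0 ⊆ D` always (nothing is removed at `n = 0`), so putting a small open neighbourhood of `1` first gives (a)
  (`subset_domainOfCover_zero`);
* if `C ⊆ V 0 ∪ … ∪ V N` (a finite subcover of the compact `C`), then `D ∩ Γ•C ⊆ V 0 ∪ … ∪ V N`: a point `x ∈ D`
  lies in `V n` for the LEAST `n` whose saturation contains `x`, and `x ∈ Γ•C` means `γ x ∈ V m` for some `m ≤ N`, so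
  `n ≤ m ≤ N` (`domainOfCover_inter_saturate_subset`) — and `V 0 ∪ … ∪ V N` lies in a compact set: (b).
The existence theorem `exists_fundamentalDomain_of_discrete_saturate` packages this (measurable fundamental domain
for every measure, unique orbit representatives, `D ∈ 𝓝 1`, `D ∩ Γ•C` inside a compact for every compact `C`);
`exists_fundamentalDomain_of_discrete_saturate_closure` is the `IsCompact (closure …)` form (Hausdorff `G`), and
`exists_fundamentalDomain_of_discrete_of_central_cocompact` is the shape of S14455 (iv) for a CENTRAL `Γ ≤ Z` with
`Z ⊆ Γ·E`, `E` compact: `D ∩ C·Z ⊆ D ∩ Γ•(C·E)` because `c γ e = γ c e`.  The Borel-transversal literature fact of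
S14455 is therefore not consumed by this route; `Z(k)\Z_f` compact (`hZc`) and the discreteness of `Z(k)` in `T_f`
stay the consumer's inputs — and discreteness follows from `CentreFinFinite` by `discreteTopology_of_finite_inter_nhds`
(a subgroup meeting a neighbourhood of `1` in a finite set is discrete: shrink the neighbourhood past the finitely
many non-identity elements, `T1`).

Consumers: the Line-4 factorisation chain (C-L4-ZDOMAIN-EX (iii)/(iv) on `torusFin W`, `centreFin W`, `ZfIn W`) and any
line needing a fundamental domain of a discrete central subgroup with controlled compactness.  The instantiation on
`torusFin W` needs `[LocallyCompactSpace] [SecondCountableTopology] [T2Space]` of the subtype (closed subgroup of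
`GA W`: `isClosed_torusT`, `isClosed_finitePart`, `locallyCompact_GA`, `secondCountable_GA`) and the centrality of
`centreFin W` in `torusFin W` (image of central elements under the surjective `finTfHom`).

Nothing here says anything about the status of the Hodge conjecture for CM abelian varieties, which is NOT proved
(HC_CM is NOT proved by anyone in this repository).
-/

set_option autoImplicit false

noncomputable section

namespace Summit.Ventures.HodgeRepro.Tier4.Common

open MeasureTheory Set Filter Topology
open scoped Pointwise

/-! ## 1. A subgroup meeting a neighbourhood of `1` in a finite set is discrete -/

section DiscreteOfFinite

variable {G : Type*} [Group G] [TopologicalSpace G] [IsTopologicalGroup G] [T1Space G]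

/-- **A subgroup meeting a neighbourhood of `1` in a finite set is discrete**: `V := interior U ∖ ((Γ ∩ U) ∖ {1})` is
open (finite sets are closed, `T1`), contains `1`, and `V ∩ Γ = {1}`; so `{1}` is open in `Γ` and `Γ` is discrete
(`discreteTopology_of_isOpen_singleton_one`).  Consumer: S14455 (iii) `CentreFinFinite W → DiscreteTopology (centreFin W)`
with `U := K` the compact open subgroup of `T_f` (open ⇒ a neighbourhood of `1`). -/
theorem discreteTopology_of_finite_inter_nhds (Γ : Subgroup G) (U : Set G) (hU : U ∈ 𝓝 (1 : G))
    (hfin : ((Γ : Set G) ∩ U).Finite) : DiscreteTopology Γ := by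
  refine discreteTopology_of_isOpen_singleton_one ?_
  rw [isOpen_induced_iff]
  refine ⟨interior U \ (((Γ : Set G) ∩ U) \ {1}),
    isOpen_interior.sdiff (hfin.subset Set.sdiff_subset).isClosed, ?_⟩
  ext γ
  simp only [mem_preimage, Set.mem_singleton_iff]
  constructor
  · rintro ⟨hγU, h⟩
    have h1 : (γ : G) = 1 := by
      by_contra hne
      exact h ⟨⟨γ.2, interior_subset hγU⟩, hne⟩
    exact Subtype.ext h1
  · rintro rfl
    refine ⟨mem_interior_iff_mem_nhds.mpr (by simpa using hU), ?_⟩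
    rintro ⟨-, hne⟩
    exact hne rfl

end DiscreteOfFinite

/-! ## 2. The cover construction: `V 0 ⊆ D`, and `D ∩ Γ•C` lies in the first sets of the cover -/

section Saturation

variable {Γ X : Type*} [Group Γ] [MulAction Γ X]

/-- Nothing is removed from the first set of the cover: `V 0 ⊆ domainOfCover V`. -/
theorem subset_domainOfCover_zero (V : ℕ → Set X) : V 0 ⊆ domainOfCover (Γ := Γ) V := by
  intro x hx
  rw [mem_domainOfCover]
  exact ⟨0, hx, fun m hm => absurd hm (Nat.not_lt_zero m)⟩

/-- **The domain meets a saturation only through the first sets of the cover**: if `C ⊆ V 0 ∪ … ∪ V N`, then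
`domainOfCover V ∩ Γ•C ⊆ V 0 ∪ … ∪ V N` — a point of the domain lies in `V n` for the LEAST `n` whose saturation
contains it, and a point of `Γ•C` has a translate in some `V m`, `m ≤ N`, so `n ≤ m`. -/
theorem domainOfCover_inter_saturate_subset (V : ℕ → Set X) (N : ℕ) (C : Set X)
    (hC : C ⊆ ⋃ n ∈ Finset.range (N + 1), V n) :
    domainOfCover (Γ := Γ) V ∩ saturate (Γ := Γ) C ⊆ ⋃ n ∈ Finset.range (N + 1), V n := by
  rintro x ⟨hxD, hxC⟩
  rw [mem_domainOfCover] at hxD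
  obtain ⟨n, hn, hmin⟩ := hxD
  obtain ⟨γ, hγ⟩ := mem_saturate.mp hxC
  have hmem := hC hγ
  simp only [mem_iUnion, Finset.mem_range, exists_prop] at hmem
  obtain ⟨m, hmN, hm⟩ := hmem
  have hxm : x ∈ saturate (Γ := Γ) (V m) := mem_saturate.mpr ⟨γ, hm⟩
  have hnm : n ≤ m := by
    by_contra h
    exact hmin m (lt_of_not_ge h) hxm
  simp only [mem_iUnion, Finset.mem_range, exists_prop]
  exact ⟨n, by omega, hn⟩

end Saturation

/-! ## 3. Existence: a fundamental domain containing a neighbourhood of `1`, relatively compact on saturations -/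

section Existence

variable {G : Type*} [Group G] [TopologicalSpace G] [IsTopologicalGroup G]

omit [IsTopologicalGroup G] in
/-- A discrete subgroup of a second-countable group is countable (second countable ⇒ hereditarily Lindelöf ⇒ the
subtype is Lindelöf; Lindelöf + discrete ⇒ countable). -/
theorem countable_of_discrete_of_secondCountable [SecondCountableTopology G] (Γ : Subgroup G)
    [DiscreteTopology Γ] : Countable Γ :=
  countable_of_Lindelof_of_discrete

/-- **Fundamental domains relatively compact on saturations of compacts.**  For a discrete subgroup `Γ` of a locally
compact second-countable topological group `G` (Borel σ-algebra) and ANY measure `μ` there is a measurable `D` with: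
`D` is a fundamental domain for `Γ` (left multiplication) meeting every orbit in exactly one point; `D` is a
neighbourhood of `1`; and for every compact `C` the set `D ∩ Γ•C` lies in a compact set.  No cocompactness, no
quotient, no section: the cover construction `domainOfCover` of `FundamentalDomainExists` with a small open
neighbourhood of `1` placed first. -/
theorem exists_fundamentalDomain_of_discrete_saturate [LocallyCompactSpace G] [SecondCountableTopology G]
    [MeasurableSpace G] [BorelSpace G] (Γ : Subgroup G) [DiscreteTopology Γ] (μ : Measure G) :
    ∃ D : Set G, MeasurableSet D ∧ IsFundamentalDomain Γ D μ ∧ (∀ x : G, ∃! γ : Γ, γ • x ∈ D) ∧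
      D ∈ 𝓝 (1 : G) ∧
      ∀ C : Set G, IsCompact C → ∃ L : Set G, IsCompact L ∧ D ∩ saturate (Γ := Γ) C ⊆ L := by
  haveI : Countable Γ := countable_of_discrete_of_secondCountable Γ
  -- small open neighbourhoods inside compact sets
  have hUex : ∀ g : G, ∃ U : Set G, IsOpen U ∧ g ∈ U ∧ (∃ L : Set G, IsCompact L ∧ U ⊆ L) ∧
      ∀ γ : Γ, γ ≠ 1 → Disjoint ((γ : G) • U) U := by
    intro g
    obtain ⟨U, hU, hgU, hsmall⟩ := exists_isOpen_smul_disjoint Γ g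
    obtain ⟨L, hL, hLg⟩ := exists_compact_mem_nhds g
    refine ⟨U ∩ interior L, hU.inter isOpen_interior, ⟨hgU, mem_interior_iff_mem_nhds.mpr hLg⟩,
      ⟨L, hL, Set.inter_subset_right.trans interior_subset⟩, fun γ hγ => ?_⟩
    exact disjoint_smul_of_subset Set.inter_subset_left (hsmall γ hγ)
  choose U hU hgU hUL hsmall using hUex
  choose L hL hUL' using hUL
  obtain ⟨T, hTc, hTU⟩ := TopologicalSpace.isOpen_iUnion_countable U hU
  have hTne : T.Nonempty := by
    by_contra h
    rw [Set.not_nonempty_iff_eq_empty] at h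
    have : (1 : G) ∈ ⋃ i ∈ T, U i := by rw [hTU]; exact Set.mem_iUnion.mpr ⟨1, hgU 1⟩
    simp [h] at this
  obtain ⟨e, hT⟩ := hTc.exists_eq_range hTne
  -- the cover: the small neighbourhood of `1` first, then the countable subcover
  let V : ℕ → Set G := fun n => match n with
    | 0 => U 1
    | m + 1 => U (e m)
  let L' : ℕ → Set G := fun n => match n with
    | 0 => L 1
    | m + 1 => L (e m)
  have hV0 : V 0 = U 1 := rfl
  have hVs : ∀ m, V (m + 1) = U (e m) := fun _ => rfl
  have hVopen : ∀ n, IsOpen (V n) := by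
    intro n
    cases n with
    | zero => exact hU 1
    | succ m => exact hU (e m)
  have hVL : ∀ n, V n ⊆ L' n := by
    intro n
    cases n with
    | zero => exact hUL' 1
    | succ m => exact hUL' (e m)
  have hL'c : ∀ n, IsCompact (L' n) := by
    intro n
    cases n with
    | zero => exact hL 1
    | succ m => exact hL (e m)
  have hcover : ∀ x : G, ∃ n, x ∈ V n := by
    intro x
    have : x ∈ ⋃ i ∈ T, U i := by rw [hTU]; exact Set.mem_iUnion.mpr ⟨x, hgU x⟩
    rw [hT] at this
    simp only [Set.mem_iUnion, Set.mem_range, exists_prop, exists_exists_eq_and] at this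
    obtain ⟨m, hm⟩ := this
    exact ⟨m + 1, by rw [hVs]; exact hm⟩
  have hsmall' : ∀ (n : ℕ) (γ : Γ), γ ≠ 1 → Disjoint (γ • V n) (V n) := by
    intro n γ hγ
    cases n with
    | zero => exact hsmall 1 γ hγ
    | succ m => exact hsmall (e m) γ hγ
  have hVm : ∀ n, MeasurableSet (V n) := fun n => (hVopen n).measurableSet
  have hact : ∀ γ : Γ, Measurable fun x : G => γ • x := fun γ => (continuous_const_smul γ).measurable
  refine ⟨domainOfCover (Γ := Γ) V, measurableSet_domainOfCover V hVm hact,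
    isFundamentalDomain_domainOfCover μ V hVm hact hcover hsmall',
    exists_unique_smul_mem_domainOfCover V hcover hsmall', ?_, ?_⟩
  · -- `V 0 = U 1` is an open neighbourhood of `1` inside the domain
    exact Filter.mem_of_superset ((hU 1).mem_nhds (hgU 1)) (hV0 ▸ subset_domainOfCover_zero V)
  · intro C hC
    -- finitely many `V n` cover `C`
    have hCsub : C ⊆ ⋃ n, V n := fun x _ => Set.mem_iUnion.mpr (hcover x)
    obtain ⟨t, ht⟩ := hC.elim_finite_subcover V hVopen hCsub
    let N : ℕ := t.sup id
    have hCN : C ⊆ ⋃ n ∈ Finset.range (N + 1), V n := by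
      intro x hx
      have := ht hx
      simp only [Set.mem_iUnion, exists_prop] at this
      obtain ⟨n, hnt, hn⟩ := this
      simp only [Set.mem_iUnion, Finset.mem_range, exists_prop]
      exact ⟨n, Nat.lt_succ_of_le (Finset.le_sup (f := id) hnt), hn⟩
    refine ⟨⋃ n ∈ Finset.range (N + 1), L' n,
      (Finset.range (N + 1)).isCompact_biUnion fun n _ => hL'c n, ?_⟩
    exact (domainOfCover_inter_saturate_subset V N C hCN).trans
      (Set.iUnion₂_mono fun n _ => hVL n)

/-- The `IsCompact (closure …)` form (Hausdorff `G`): a measurable fundamental domain containing a neighbourhood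
of `1`, with `closure (D ∩ Γ•C)` compact for every compact `C`. -/
theorem exists_fundamentalDomain_of_discrete_saturate_closure [T2Space G] [LocallyCompactSpace G]
    [SecondCountableTopology G] [MeasurableSpace G] [BorelSpace G] (Γ : Subgroup G) [DiscreteTopology Γ]
    (μ : Measure G) :
    ∃ D : Set G, MeasurableSet D ∧ IsFundamentalDomain Γ D μ ∧ (∃ U ∈ 𝓝 (1 : G), U ⊆ D) ∧
      ∀ C : Set G, IsCompact C → IsCompact (closure (D ∩ saturate (Γ := Γ) C)) := by
  obtain ⟨D, hDm, hDfd, -, hD1, hDC⟩ := exists_fundamentalDomain_of_discrete_saturate Γ μ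
  refine ⟨D, hDm, hDfd, ⟨D, hD1, le_rfl⟩, fun C hC => ?_⟩
  obtain ⟨L, hL, hDL⟩ := hDC C hC
  exact hL.closure_of_subset hDL

omit [TopologicalSpace G] [IsTopologicalGroup G] in
/-- `C·Z ⊆ Γ•(C·E)` when `Γ` is central and `Z ⊆ Γ·E`: `c (γ e) = γ (c e)`. -/
theorem mul_subset_saturate_mul {Γ Z : Subgroup G} (hΓ : Γ ≤ Subgroup.center G) {E : Set G}
    (hZE : (Z : Set G) ⊆ (Γ : Set G) * E) (C : Set G) :
    C * (Z : Set G) ⊆ saturate (Γ := Γ) (C * E) := by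
  rintro x ⟨c, hc, z, hz, rfl⟩
  obtain ⟨γ, hγ, e, he, rfl⟩ := hZE hz
  refine mem_saturate.mpr ⟨⟨γ, hγ⟩⁻¹, ?_⟩
  have hcomm : c * γ = γ * c := Subgroup.mem_center_iff.mp (hΓ hγ) c
  have key : (⟨γ, hγ⟩ : Γ)⁻¹ • (c * (γ * e)) = c * e := by
    rw [Subgroup.smul_def, smul_eq_mul, Subgroup.coe_inv, Subgroup.coe_mk, ← mul_assoc c, hcomm,
      mul_assoc γ, ← mul_assoc, inv_mul_cancel, one_mul]
  rw [key]
  exact ⟨c, hc, e, he, rfl⟩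

/-- **The shape of S14455 (iv)**: `Γ` a discrete CENTRAL subgroup of a locally compact second-countable Hausdorff
group, `Z` a subgroup with `Z ⊆ Γ·E` for a compact `E` («`Γ\Z` compact»); then there is a measurable fundamental
domain `D` for `Γ`, containing a neighbourhood of `1`, with `closure (D ∩ C·Z)` compact for every compact `C` — no
Borel section of `G → G/Z` is used.  Instantiation: `G := torusFin W`, `Γ := centreFin W`, `Z := ZfIn W`,
`μ := ν_f`. -/
theorem exists_fundamentalDomain_of_discrete_of_central_cocompact [T2Space G] [LocallyCompactSpace G]
    [SecondCountableTopology G] [MeasurableSpace G] [BorelSpace G] (Γ : Subgroup G) [DiscreteTopology Γ]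
    (μ : Measure G) (Z : Subgroup G) (hΓ : Γ ≤ Subgroup.center G)
    (hZ : ∃ E : Set G, IsCompact E ∧ (Z : Set G) ⊆ (Γ : Set G) * E) :
    ∃ D : Set G, MeasurableSet D ∧ IsFundamentalDomain Γ D μ ∧ (∃ U ∈ 𝓝 (1 : G), U ⊆ D) ∧
      ∀ C : Set G, IsCompact C → IsCompact (closure (D ∩ (C * (Z : Set G)))) := by
  obtain ⟨E, hE, hZE⟩ := hZ
  obtain ⟨D, hDm, hDfd, hD1, hDC⟩ := exists_fundamentalDomain_of_discrete_saturate_closure Γ μ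
  refine ⟨D, hDm, hDfd, hD1, fun C hC => ?_⟩
  exact (hDC (C * E) (hC.mul hE)).of_isClosed_subset isClosed_closure
    (closure_mono (Set.inter_subset_inter_right D (mul_subset_saturate_mul hΓ hZE C)))

end Existence

end Summit.Ventures.HodgeRepro.Tier4.Common

end
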